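import Summits.BirchSwinnertonDyer.BirchSwinnertonDyer.Theorems.ByReductionTypeAtTwoAdditivePotMultConjATwoNarrowTwo3736Integers
import Literature.NumberTheory.EllipticCurves.CyclotomicZpExtensionLayerGeneratorProofs
import HarnessLib

/-!
# C4″ `AdditivePotMultOverKAtTwo` (item stmt-BirchSwinnertonDyer-22618), the (I1M′) input of the upper half on the `0 < Δ` rows:
# LAYER-TWO NARROW CERTIFICATE `d = 3736`, part PARITY — `h(A₂)` is ODD for `A₂ = ℚ(θ) ⊔ ℚ_2`, by genus theory for `A₂/A₁` with the non-norm unit `ε`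
# (k4-w1's `…316LayerTwoParity` transported; KERNEL; rows 209216h1)

Cell `bsd-2adic`, rung K4, seat `bsd-2adic-k4-w3` GEN 13 (explicit unit of director-bsd g16 (309)(7); `--supports stmt-BirchSwinnertonDyer-22618`).
HONEST FRAMING (D-0036/D-0054/D-0152): THEOREMS ONLY (no definition, no named fact, no `sorry`, no instance). The series `…NarrowTwo3736{Class, Field,
Dyadic, Residues, TotPos, Integers, Parity, SignsA/B/C, Units, Rows}` carries k4-w1 GEN 11's zero-hypothesis LAYER-TWO narrow certificate (row `261648q1`,
`…NarrowRankCertificate316*`: `h(A₁)`, `h(A₂)` odd by genus theory with one dyadic non-norm unit, ONE totally positive non-square unit of `A₁ = ℚ(θ,√2)`,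
ELEVEN sign-independent units of `A₂ = ℚ(θ,√(2+√2))`, k4-w2's Edgar–Mollin–Peterson door `a = 1, b = 11`, cruxlead-19573-w2's rung `m = 1`) to the
totally real cubic `2`-torsion field of discriminant `3736` (`X³ + (-1)X² + (-14)X + (22)`) of the C4″ census rows 209216h1 (eng-2 CERT-ADD-POTMULT-POS81-AB-E2:
`n₀ = 0`, `rank₂ Cl⁺ = [0,1,1]`, unit signature ranks `[3,5,11]`, `h = 1` at layers `0,1,2` — letter NARROW-EQUAL12, instrument grade `grh`; here KERNEL).
All certificates were found by the seat's exact-arithmetic tools (`k4w3/gen13/tools`: GEN 12 `narrowcert/unitlib` + layer-two arithmetic `nf12/cert2`) and are CHECKED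
HERE by the kernel. Statement (A) is NOT BSD: BSD₂ for these curves is not proved; C4″ / (I1M′) stay research-open; nothing booked; no row of 22618 changes tier
(pen RC-490 (4)); BSD is not proved by any of this.

References: [CoatesSujatha2005] Conj. A, Thm. 3.4; [Fukuda1994] Thm. 1 (2); [EdgarMollinPeterson1986] Thm. 2.1; [FrohlichTaylor1990] Ch. V §1 (1.8)–(1.13);
[Lang1990] Ch. 13 §4 Lemma 4.1; [Washington1997] §13.1, Prop. 13.2; [Cohen1993] §4.1.3, §6.3; [Marcus1977] Ch. 5 Thm. 22, 35–37; [Omeara1963] §63.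
-/

set_option autoImplicit false
-- sibling precedent: the directory name repeats the summit name
set_option linter.dupNamespace false

noncomputable section

open scoped Classical IntermediateField NumberField nonZeroDivisors Polynomial

namespace Summit.BirchSwinnertonDyer.BirchSwinnertonDyer.Theorems.AddKatoTwo

open Polynomial IsDedekindDomain NumberField Field IntermediateField
  Literature.NumberTheory.EllipticCurves Literature.NumberTheory.EllipticCurves.ZpExtension
  Literature.NumberTheory.IwasawaTheory Literature.NumberTheory.NumberFields
  Literature.NumberTheory.GaloisRepresentations Literature.Geometry.Kaehler.ComplexTorus

variable {θ : AlgebraicClosure ℚ}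

set_option linter.unusedSimpArgs false in
set_option maxHeartbeats 1600000 in
/-- **`h(ℚ(θ) ⊔ ℚ_2)` is ODD for `θ³ + (-1)θ² + (-14)θ + (22) = 0`** (`ℚ(θ, √(2+√2))`, the second cyclotomic layer of the cubic field of discriminant `3736`):
genus theory for `A₂/A₁` — at most the two dyadic primes `(ξ)`, `(η)` of `A₁` ramify, no infinite place, `h(A₁)` odd, and `ε = 17 - 15 * θ + 3 * θ ^ 2` is not a norm
(k4-w1's `odd_classNumber_adjoin_sup_layer_two_d316` transported to `d = 3736`). KERNEL. [cite: Lang1990, Ch. 13 §4, Lemma 4.1 (PDF pp. 203–204)] [cite: Gras2003, IV.4 (genus theory)]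
[cite: Washington1997, §13.1] -/
theorem odd_classNumber_adjoin_sup_layer_two_d3736
    (hθ : aeval θ (Cubic.toPoly ⟨1, ((-1 : ℤ) : ℚ), ((-14 : ℤ) : ℚ), ((22 : ℤ) : ℚ)⟩) = 0) :
    haveI : FiniteDimensional ℚ ↥ℚ⟮θ⟯ :=
      IntermediateField.adjoin.finiteDimensional ⟨_, Cubic.monic_of_a_eq_one', by rwa [← aeval_def]⟩
    haveI : FiniteDimensional ℚ ↥((CyclotomicZp.zpExtension 2).layer 2) := (CyclotomicZp.zpExtension 2).finiteDimensional_layer_holds 2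
    haveI : NumberField ↥(ℚ⟮θ⟯ ⊔ (CyclotomicZp.zpExtension 2).layer 2) := NumberField.mk
    Odd (classNumber ↥(ℚ⟮θ⟯ ⊔ (CyclotomicZp.zpExtension 2).layer 2)) := by
  haveI : FiniteDimensional ℚ ↥ℚ⟮θ⟯ :=
    IntermediateField.adjoin.finiteDimensional ⟨_, Cubic.monic_of_a_eq_one', by rwa [← aeval_def]⟩
  haveI : FiniteDimensional ℚ ↥((CyclotomicZp.zpExtension 2).layer 1) := (CyclotomicZp.zpExtension 2).finiteDimensional_layer_holds 1
  haveI : FiniteDimensional ℚ ↥((CyclotomicZp.zpExtension 2).layer 2) := (CyclotomicZp.zpExtension 2).finiteDimensional_layer_holds 2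
  haveI : NumberField ↥ℚ⟮θ⟯ := NumberField.mk
  haveI : NumberField ↥(ℚ⟮θ⟯ ⊔ (CyclotomicZp.zpExtension 2).layer 1) := NumberField.mk
  haveI : NumberField ↥(ℚ⟮θ⟯ ⊔ (CyclotomicZp.zpExtension 2).layer 2) := NumberField.mk
  obtain ⟨hreal2, hfin2, h3⟩ := layer_two_basics irreducible_cubic_d3736p hθ (isTotallyReal_adjoin_d3736p hθ)
  obtain ⟨-, hfin1, -⟩ := layer_one_basics irreducible_cubic_d3736p hθ (isTotallyReal_adjoin_d3736p hθ)
  haveI := hreal2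
  have hodd3 : Odd (Module.finrank ℚ ↥ℚ⟮θ⟯) := by rw [h3]; decide
  -- a root `e ∈ ℚ_2` of `Ψ₂` and `t = e² − 2 ∈ ℚ_1`
  obtain ⟨e, he, -, he4⟩ := CyclotomicZp.exists_mem_layer_two_quartic_zpExtension
  have he0 : (fun x : AlgebraicClosure ℚ => x ^ 2 - 2)^[2] e = 0 := by
    simp only [Function.iterate_succ, Function.iterate_zero, Function.comp_apply, id_eq]
    linear_combination he4
  obtain ⟨ht, ht2⟩ := sq_sub_two_mem_layer_one_d316 he0
  -- the tower `ℚ(θ) ≤ A₁ ≤ A₂`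
  have hK1 : ℚ⟮θ⟯ ≤ ℚ⟮θ⟯ ⊔ (CyclotomicZp.zpExtension 2).layer 1 := le_sup_left
  have hK2 : ℚ⟮θ⟯ ≤ ℚ⟮θ⟯ ⊔ (CyclotomicZp.zpExtension 2).layer 2 := le_sup_left
  have h12 : ℚ⟮θ⟯ ⊔ (CyclotomicZp.zpExtension 2).layer 1 ≤ ℚ⟮θ⟯ ⊔ (CyclotomicZp.zpExtension 2).layer 2 :=
    sup_le_sup_left ((CyclotomicZp.zpExtension 2).layer_mono (by norm_num : 1 ≤ 2)) _
  letI : Algebra ↥ℚ⟮θ⟯ ↥(ℚ⟮θ⟯ ⊔ (CyclotomicZp.zpExtension 2).layer 1) := (inclusion hK1).toRingHom.toAlgebra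
  letI : Algebra ↥ℚ⟮θ⟯ ↥(ℚ⟮θ⟯ ⊔ (CyclotomicZp.zpExtension 2).layer 2) := (inclusion hK2).toRingHom.toAlgebra
  letI : Algebra ↥(ℚ⟮θ⟯ ⊔ (CyclotomicZp.zpExtension 2).layer 1) ↥(ℚ⟮θ⟯ ⊔ (CyclotomicZp.zpExtension 2).layer 2) :=
    (inclusion h12).toRingHom.toAlgebra
  have halg12 : ∀ c, algebraMap ↥(ℚ⟮θ⟯ ⊔ (CyclotomicZp.zpExtension 2).layer 1) ↥(ℚ⟮θ⟯ ⊔ (CyclotomicZp.zpExtension 2).layer 2) c =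
      inclusion h12 c := fun _ => rfl
  haveI : IsScalarTower ℚ ↥ℚ⟮θ⟯ ↥(ℚ⟮θ⟯ ⊔ (CyclotomicZp.zpExtension 2).layer 1) :=
    IsScalarTower.of_algebraMap_eq fun q => ((inclusion hK1).commutes q).symm
  haveI : IsScalarTower ℚ ↥ℚ⟮θ⟯ ↥(ℚ⟮θ⟯ ⊔ (CyclotomicZp.zpExtension 2).layer 2) :=
    IsScalarTower.of_algebraMap_eq fun q => ((inclusion hK2).commutes q).symm
  haveI : IsScalarTower ℚ ↥(ℚ⟮θ⟯ ⊔ (CyclotomicZp.zpExtension 2).layer 1) ↥(ℚ⟮θ⟯ ⊔ (CyclotomicZp.zpExtension 2).layer 2) :=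
    IsScalarTower.of_algebraMap_eq fun q => ((inclusion h12).commutes q).symm
  haveI : IsScalarTower ↥ℚ⟮θ⟯ ↥(ℚ⟮θ⟯ ⊔ (CyclotomicZp.zpExtension 2).layer 1) ↥(ℚ⟮θ⟯ ⊔ (CyclotomicZp.zpExtension 2).layer 2) :=
    IsScalarTower.of_algebraMap_eq fun _ => rfl
  haveI : Module.Finite ↥ℚ⟮θ⟯ ↥(ℚ⟮θ⟯ ⊔ (CyclotomicZp.zpExtension 2).layer 1) := Module.Finite.of_restrictScalars_finite ℚ ↥ℚ⟮θ⟯ _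
  haveI : Module.Finite ↥ℚ⟮θ⟯ ↥(ℚ⟮θ⟯ ⊔ (CyclotomicZp.zpExtension 2).layer 2) := Module.Finite.of_restrictScalars_finite ℚ ↥ℚ⟮θ⟯ _
  haveI : Module.Finite ↥(ℚ⟮θ⟯ ⊔ (CyclotomicZp.zpExtension 2).layer 1) ↥(ℚ⟮θ⟯ ⊔ (CyclotomicZp.zpExtension 2).layer 2) :=
    Module.Finite.of_restrictScalars_finite ℚ _ _
  have hdegK1 : Module.finrank ↥ℚ⟮θ⟯ ↥(ℚ⟮θ⟯ ⊔ (CyclotomicZp.zpExtension 2).layer 1) = 2 := by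
    have htower := Module.finrank_mul_finrank ℚ ↥ℚ⟮θ⟯ ↥(ℚ⟮θ⟯ ⊔ (CyclotomicZp.zpExtension 2).layer 1)
    rw [h3, hfin1] at htower
    omega
  have hdeg12 : Module.finrank ↥(ℚ⟮θ⟯ ⊔ (CyclotomicZp.zpExtension 2).layer 1) ↥(ℚ⟮θ⟯ ⊔ (CyclotomicZp.zpExtension 2).layer 2) = 2 := by
    have htower := Module.finrank_mul_finrank ℚ ↥(ℚ⟮θ⟯ ⊔ (CyclotomicZp.zpExtension 2).layer 1) ↥(ℚ⟮θ⟯ ⊔ (CyclotomicZp.zpExtension 2).layer 2)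
    rw [hfin1, hfin2] at htower
    omega
  haveI : Algebra.IsQuadraticExtension ↥(ℚ⟮θ⟯ ⊔ (CyclotomicZp.zpExtension 2).layer 1) ↥(ℚ⟮θ⟯ ⊔ (CyclotomicZp.zpExtension 2).layer 2) :=
    ⟨hdeg12⟩
  haveI : IsGalois ↥(ℚ⟮θ⟯ ⊔ (CyclotomicZp.zpExtension 2).layer 1) ↥(ℚ⟮θ⟯ ⊔ (CyclotomicZp.zpExtension 2).layer 2) := inferInstance
  -- `e`, `t` as elements
  have heA : e ∈ ℚ⟮θ⟯ ⊔ (CyclotomicZp.zpExtension 2).layer 2 := (le_sup_right : (CyclotomicZp.zpExtension 2).layer 2 ≤ _) he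
  have htA : e ^ 2 - 2 ∈ ℚ⟮θ⟯ ⊔ (CyclotomicZp.zpExtension 2).layer 1 := (le_sup_right : (CyclotomicZp.zpExtension 2).layer 1 ≤ _) ht
  set e' : ↥(ℚ⟮θ⟯ ⊔ (CyclotomicZp.zpExtension 2).layer 2) := ⟨e, heA⟩ with he'def
  set t' : ↥(ℚ⟮θ⟯ ⊔ (CyclotomicZp.zpExtension 2).layer 1) := ⟨e ^ 2 - 2, htA⟩ with ht'def
  have he'0 : (fun x : ↥(ℚ⟮θ⟯ ⊔ (CyclotomicZp.zpExtension 2).layer 2) => x ^ 2 - 2)^[2] e' = 0 := by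
    apply (algebraMap ↥(ℚ⟮θ⟯ ⊔ (CyclotomicZp.zpExtension 2).layer 2) (AlgebraicClosure ℚ)).injective
    rw [NestedSqrtTwo.map_iterate, map_zero]
    exact he0
  have hs : e' ^ 2 = algebraMap ↥(ℚ⟮θ⟯ ⊔ (CyclotomicZp.zpExtension 2).layer 1) ↥(ℚ⟮θ⟯ ⊔ (CyclotomicZp.zpExtension 2).layer 2) (2 + t') := by
    apply (algebraMap ↥(ℚ⟮θ⟯ ⊔ (CyclotomicZp.zpExtension 2).layer 2) (AlgebraicClosure ℚ)).injective
    rw [halg12]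
    change e ^ 2 = 2 + (e ^ 2 - 2)
    ring
  -- `e ∉ A₁`: `deg minpoly_{ℚ(θ)}(e) = 4 > 2 = [A₁ : ℚ(θ)]`
  have hsK : e' ∉ Set.range (algebraMap ↥(ℚ⟮θ⟯ ⊔ (CyclotomicZp.zpExtension 2).layer 1) ↥(ℚ⟮θ⟯ ⊔ (CyclotomicZp.zpExtension 2).layer 2)) := by
    rintro ⟨c, hc⟩
    have h4 : (minpoly ↥ℚ⟮θ⟯ e').natDegree = 4 := by
      rw [NestedSqrtTwo.minpoly_eq_of_odd_finrank hodd3 e' he'0, NestedSqrtTwo.natDegree_eq]; norm_num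
    rw [← hc, minpoly.algebraMap_eq (algebraMap ↥(ℚ⟮θ⟯ ⊔ (CyclotomicZp.zpExtension 2).layer 1)
      ↥(ℚ⟮θ⟯ ⊔ (CyclotomicZp.zpExtension 2).layer 2)).injective] at h4
    have hle := minpoly.natDegree_le (A := ↥ℚ⟮θ⟯) c
    rw [h4, hdegK1] at hle
    omega
  -- layer-1 integers and the non-norm unit `ε`
  obtain ⟨bA, xA, sA, v₂, hbAval, hsAval, -, RbA, RxA, -, hsA2, -, -, -, -, hPξ, hPψ, hv₂unit, hv₂⟩ := layer_one_dyadic_d3736 hθ ht ht2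
  obtain ⟨-, -, -, -, -, -, -, -, -, -, hεinv0⟩ := layer_one_ids_d3736 bA xA RbA RxA
  have hεinv : (17 - 15 * bA + 3 * bA ^ 2) * (35 - 3 * bA - 3 * bA ^ 2) = 1 := by linear_combination hεinv0
  set εu : (𝓞 ↥(ℚ⟮θ⟯ ⊔ (CyclotomicZp.zpExtension 2).layer 1))ˣ := Units.mkOfMulEqOne _ _ hεinv with hεudef
  have hεval : ((εu : 𝓞 ↥(ℚ⟮θ⟯ ⊔ (CyclotomicZp.zpExtension 2).layer 1)) : ↥(ℚ⟮θ⟯ ⊔ (CyclotomicZp.zpExtension 2).layer 1)) =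
      inclusion hK1 (17 - 15 * AdjoinSimple.gen ℚ θ + 3 * AdjoinSimple.gen ℚ θ ^ 2) := by
    rw [hεudef, Units.val_mkOfMulEqOne, NumberField.RingOfIntegers.coe_eq_algebraMap]
    simp only [map_add, map_sub, map_mul, map_pow, map_ofNat, map_neg, map_one, hbAval]
  have hne : ∀ a c : ↥(ℚ⟮θ⟯ ⊔ (CyclotomicZp.zpExtension 2).layer 1),
      a ^ 2 - (2 + t') * c ^ 2 ≠ ((εu : 𝓞 ↥(ℚ⟮θ⟯ ⊔ (CyclotomicZp.zpExtension 2).layer 1)) : ↥(ℚ⟮θ⟯ ⊔ (CyclotomicZp.zpExtension 2).layer 1)) := by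
    intro a c h
    exact not_exists_sq_sub_mul_sq_eq_eps_sup_layer_one_d3736 hθ ht ht2 ⟨a, c, by rw [h, hεval]⟩
  have hK : Odd (classNumber ↥(ℚ⟮θ⟯ ⊔ (CyclotomicZp.zpExtension 2).layer 1)) := odd_classNumber_adjoin_sup_layer_one_d3736 hθ
  -- the integer `e` of `A₂`: `e² = 2 + t`, `A₂ = A₁[e]`
  set sB : 𝓞 ↥(ℚ⟮θ⟯ ⊔ (CyclotomicZp.zpExtension 2).layer 2) := ⟨e', NestedSqrtTwo.isIntegral he'0⟩ with hsBdef
  have hsBval : algebraMap (𝓞 ↥(ℚ⟮θ⟯ ⊔ (CyclotomicZp.zpExtension 2).layer 2)) ↥(ℚ⟮θ⟯ ⊔ (CyclotomicZp.zpExtension 2).layer 2) sB = e' := rfl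
  have hsB2 : sB ^ 2 = algebraMap (𝓞 ↥(ℚ⟮θ⟯ ⊔ (CyclotomicZp.zpExtension 2).layer 1)) (𝓞 ↥(ℚ⟮θ⟯ ⊔ (CyclotomicZp.zpExtension 2).layer 2)) (2 + sA) := by
    apply NumberField.RingOfIntegers.coe_injective
    rw [map_pow, hsBval, hs,
      ← IsScalarTower.algebraMap_apply (𝓞 ↥(ℚ⟮θ⟯ ⊔ (CyclotomicZp.zpExtension 2).layer 1)) (𝓞 ↥(ℚ⟮θ⟯ ⊔ (CyclotomicZp.zpExtension 2).layer 2))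
        ↥(ℚ⟮θ⟯ ⊔ (CyclotomicZp.zpExtension 2).layer 2),
      IsScalarTower.algebraMap_apply (𝓞 ↥(ℚ⟮θ⟯ ⊔ (CyclotomicZp.zpExtension 2).layer 1)) ↥(ℚ⟮θ⟯ ⊔ (CyclotomicZp.zpExtension 2).layer 1)
        ↥(ℚ⟮θ⟯ ⊔ (CyclotomicZp.zpExtension 2).layer 2), map_add, map_ofNat]
    change _ = algebraMap _ _ (2 + (sA : ↥(ℚ⟮θ⟯ ⊔ (CyclotomicZp.zpExtension 2).layer 1)))
    rw [hsAval, map_add, map_ofNat]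
  have htint : IsIntegral ↥(ℚ⟮θ⟯ ⊔ (CyclotomicZp.zpExtension 2).layer 1) e' := (Algebra.IsIntegral.isIntegral (R := ℚ) e').tower_top
  have hgen : IntermediateField.adjoin ↥(ℚ⟮θ⟯ ⊔ (CyclotomicZp.zpExtension 2).layer 1) ({e'} : Set ↥(ℚ⟮θ⟯ ⊔ (CyclotomicZp.zpExtension 2).layer 2)) = ⊤ := by
    have h2le : 2 ≤ (minpoly ↥(ℚ⟮θ⟯ ⊔ (CyclotomicZp.zpExtension 2).layer 1) e').natDegree := (minpoly.two_le_natDegree_iff htint).mpr hsK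
    refine IntermediateField.eq_of_le_of_finrank_eq le_top ?_
    rw [IntermediateField.adjoin.finrank htint, IntermediateField.finrank_top', hdeg12]
    exact le_antisymm ((minpoly.natDegree_le (A := ↥(ℚ⟮θ⟯ ⊔ (CyclotomicZp.zpExtension 2).layer 1)) (x := e')).trans hdeg12.le) h2le
  have hgenB : Algebra.adjoin ↥(ℚ⟮θ⟯ ⊔ (CyclotomicZp.zpExtension 2).layer 1) ({(sB : ↥(ℚ⟮θ⟯ ⊔ (CyclotomicZp.zpExtension 2).layer 2))} :
      Set ↥(ℚ⟮θ⟯ ⊔ (CyclotomicZp.zpExtension 2).layer 2)) = ⊤ := by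
    rw [← NumberField.RingOfIntegers.coe_eq_algebraMap] at hsBval
    rw [hsBval, ← IntermediateField.adjoin_simple_toSubalgebra_of_isAlgebraic htint.isAlgebraic, hgen, IntermediateField.top_toSubalgebra]
  -- at most the two dyadic primes `(π)`, `(η)` of `A₁` ramify in `A₂`
  have hram : (∏ᶠ v : HeightOneSpectrum (𝓞 ↥(ℚ⟮θ⟯ ⊔ (CyclotomicZp.zpExtension 2).layer 1)),
      v.asIdeal.ramificationIdxIn (𝓞 ↥(ℚ⟮θ⟯ ⊔ (CyclotomicZp.zpExtension 2).layer 2))) ∣ 4 := by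
    rw [AmbiguousClass.finprod_ramificationIdxIn_eq_pow_of_prime Nat.prime_two hdeg12]
    have hξ0 : Ideal.span {31 - 4 * xA - 4 * bA - bA * xA - 3 * bA ^ 2} ≠ ⊥ := by
      rw [Ne, Ideal.span_singleton_eq_bot]; intro h0; rw [h0] at hv₂; norm_num at hv₂
    have hψ0 : Ideal.span {30 - 11 * xA - bA + bA * xA - 2 * bA ^ 2 + bA ^ 2 * xA} ≠ ⊥ := by
      rw [Ne, Ideal.span_singleton_eq_bot]; intro h0; rw [h0] at hv₂; norm_num at hv₂
    set w₁ : HeightOneSpectrum (𝓞 ↥(ℚ⟮θ⟯ ⊔ (CyclotomicZp.zpExtension 2).layer 1)) := ⟨Ideal.span {31 - 4 * xA - 4 * bA - bA * xA - 3 * bA ^ 2}, hPξ, hξ0⟩ with hw₁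
    set w₂ : HeightOneSpectrum (𝓞 ↥(ℚ⟮θ⟯ ⊔ (CyclotomicZp.zpExtension 2).layer 1)) := ⟨Ideal.span {30 - 11 * xA - bA + bA * xA - 2 * bA ^ 2 + bA ^ 2 * xA}, hPψ, hψ0⟩ with hw₂
    have hsub : {v : HeightOneSpectrum (𝓞 ↥(ℚ⟮θ⟯ ⊔ (CyclotomicZp.zpExtension 2).layer 1)) |
        v.asIdeal.ramificationIdxIn (𝓞 ↥(ℚ⟮θ⟯ ⊔ (CyclotomicZp.zpExtension 2).layer 2)) ≠ 1} ⊆ {w₁, w₂} := by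
      intro v hv
      rw [Set.mem_setOf_eq] at hv
      -- `2 ∈ v` (else `v` is unramified in `A₂ = A₁(e)`, `e² = 2 + t`, `(2 + t)(2 - t) = 2`)
      have h2v : (2 : 𝓞 ↥(ℚ⟮θ⟯ ⊔ (CyclotomicZp.zpExtension 2).layer 1)) ∈ v.asIdeal := by
        by_contra h2
        apply hv
        haveI := v.isMaximal
        obtain ⟨Q, hQmax, hQover⟩ := Ideal.exists_maximal_ideal_liesOver_of_isIntegral
          (S := 𝓞 ↥(ℚ⟮θ⟯ ⊔ (CyclotomicZp.zpExtension 2).layer 2)) v.asIdeal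
        haveI := hQmax
        haveI := hQover
        rw [Ideal.ramificationIdxIn_eq_ramificationIdx v.asIdeal Q
          (↥(ℚ⟮θ⟯ ⊔ (CyclotomicZp.zpExtension 2).layer 2) ≃ₐ[↥(ℚ⟮θ⟯ ⊔ (CyclotomicZp.zpExtension 2).layer 1)]
            ↥(ℚ⟮θ⟯ ⊔ (CyclotomicZp.zpExtension 2).layer 2))]
        have hunr : Algebra.IsUnramifiedAt (𝓞 ↥(ℚ⟮θ⟯ ⊔ (CyclotomicZp.zpExtension 2).layer 1)) Q := by
          refine isUnramifiedAt_of_sq_eq hsB2 hgenB Q fun hmem => h2 ?_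
          have hu : 4 * (2 + sA) ∈ Q.under (𝓞 ↥(ℚ⟮θ⟯ ⊔ (CyclotomicZp.zpExtension 2).layer 1)) := by
            rw [Ideal.under_def, Ideal.mem_comap]; exact hmem
          rw [← Ideal.over_def Q v.asIdeal] at hu
          rcases v.isPrime.mem_or_mem hu with h | h
          · have h22 : (4 : 𝓞 ↥(ℚ⟮θ⟯ ⊔ (CyclotomicZp.zpExtension 2).layer 1)) = 2 * 2 := by norm_num
            rw [h22] at h
            exact (v.isPrime.mem_or_mem h).elim id id
          · have h2' : (2 + sA) * (2 - sA) ∈ v.asIdeal := v.asIdeal.mul_mem_right _ h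
            have heq : (2 + sA) * (2 - sA) = (2 : 𝓞 ↥(ℚ⟮θ⟯ ⊔ (CyclotomicZp.zpExtension 2).layer 1)) := by
              linear_combination (-1 : 𝓞 ↥(ℚ⟮θ⟯ ⊔ (CyclotomicZp.zpExtension 2).layer 1)) * hsA2
            rwa [heq] at h2'
        exact Ideal.ramificationIdx_eq_one_iff.mpr hunr
      -- `ξ ∈ v ∨ η ∈ v`
      rw [← hv₂] at h2v
      have hπ : (31 - 4 * xA - 4 * bA - bA * xA - 3 * bA ^ 2) ∈ v.asIdeal ∨ (30 - 11 * xA - bA + bA * xA - 2 * bA ^ 2 + bA ^ 2 * xA) ∈ v.asIdeal := by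
        rcases v.isPrime.mem_or_mem h2v with h | h
        · rcases v.isPrime.mem_or_mem h with hu | hp
          · exact absurd (Ideal.eq_top_of_isUnit_mem _ hu hv₂unit) v.isPrime.ne_top
          · exact Or.inl (v.isPrime.mem_of_pow_mem 2 hp)
        · exact Or.inr (v.isPrime.mem_of_pow_mem 4 h)
      simp only [Set.mem_insert_iff, Set.mem_singleton_iff]
      rcases hπ with h | h
      · left
        apply HeightOneSpectrum.ext
        exact ((hPξ.isMaximal hξ0).eq_of_le v.isPrime.ne_top ((Ideal.span_singleton_le_iff_mem _).mpr h)).symm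
      · right
        apply HeightOneSpectrum.ext
        exact ((hPψ.isMaximal hψ0).eq_of_le v.isPrime.ne_top ((Ideal.span_singleton_le_iff_mem _).mpr h)).symm
    have hle : {v : HeightOneSpectrum (𝓞 ↥(ℚ⟮θ⟯ ⊔ (CyclotomicZp.zpExtension 2).layer 1)) |
        v.asIdeal.ramificationIdxIn (𝓞 ↥(ℚ⟮θ⟯ ⊔ (CyclotomicZp.zpExtension 2).layer 2)) ≠ 1}.ncard ≤ 2 := by
      refine (Set.ncard_le_ncard hsub (Set.toFinite _)).trans ?_
      exact (Set.ncard_insert_le w₁ {w₂}).trans (by rw [Set.ncard_singleton])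
    calc 2 ^ {v : HeightOneSpectrum (𝓞 ↥(ℚ⟮θ⟯ ⊔ (CyclotomicZp.zpExtension 2).layer 1)) |
          v.asIdeal.ramificationIdxIn (𝓞 ↥(ℚ⟮θ⟯ ⊔ (CyclotomicZp.zpExtension 2).layer 2)) ≠ 1}.ncard ∣ 2 ^ 2 := pow_dvd_pow 2 hle
      _ = 4 := by norm_num
  exact AmbiguousClass.odd_classNumber_of_quadratic_of_isTotallyReal_of_forall_sq_sub_mul_sq_ne hdeg12 hram hs hsK εu hne hK


end Summit.BirchSwinnertonDyer.BirchSwinnertonDyer.Theorems.AddKatoTwo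

end
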